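import Literature.MathematicalPhysics.QuantumLattice.HubbardTTPrimePhaseCoexistenceExclusionLayered
import Literature.MathematicalPhysics.QuantumLattice.TIDensityPhaseCoexistenceGrandCanonical
import HarnessLib

/-!
# The INTERLAYER (c-axis) axis of the competing-orders word READ ON THE CHEMICAL-POTENTIAL AXIS: in the 3D layered `t–t'` Hubbard crystal
# no `μ` carries grand-canonical ground / equilibrium states of both excluded densities, and their chemical potentials are separated by a
# certified gap — from the 2D windows, margin `M ↦ M − (4/π)·Σ_b|t_{z,b}|`

Topic `Literature/MathematicalPhysics/QuantumLattice` (family `hubbard`; cell `pub/hubbard-downfold`, MO-S1 ↔ S2 seam «box ↦ one word», filling direction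
= the Legendre pair `μ ↔ n`; D-0096 (iii) «model order → real material: INTERLAYER COUPLING × COMPETING ORDERS»; written 2026-08-28 by
hubbard-downfold-unc-2 g23). `HubbardTTPrimePhaseCoexistenceExclusionLayered` (g21) states the c-axis law in the CANONICAL variable (no macroscopic mixture
of a `≤ n₁` and a `≥ n₂` phase is a ground / equilibrium state of the layered crystal `layeredHubbardTTPrime t t' U w tz` on `ℤ³`); `TIDensityPhaseCoexistenceGrandCanonical`
(g22) gives the model-free grand-canonical reading for ANY interaction on `ℤ^d`. This file composes the two (`d = 3`, `Ψ₃ = layeredHubbardTTPrime …`,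
any `Γ` with `e_Γ = e_{Ψ₃} − μρ`; inputs = the 2D windows, `κ := (4/π)Σ_b|tz_b|`):

* §1 `T = 0`: **`margin_le_mul_sub_chemPot_of_groundStates_layered`** — if `μ₁` carries a translation-invariant ground state of `H₃ − μ₁N` of density
  `≤ n₁` and `μ₂` one of `H₃ − μ₂N` of density `≥ n₂` (`0 < n₁ ≤ n₂ < 2`), then `a·b·(n₂ − n₁)·(μ₂ − μ₁) ≥ af₁ + bf₂ − c − κ` (2D cap `c`, 2D floors
  `fᵢ`); cost form `…_of_cost_le` (`κ ≤ k`); the one-`μ` exclusion **`IsMeanEnergyMinimiser.not_isMeanEnergyMinimiser_of_le_of_le_layered_of_cost_lt`**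
  (`c + k < af₁ + bf₂` ⇒ at ONE `μ` the ground states of `H₃ − μN` never contain both).
* §2 `T > 0` (hot anchors): **`margin_le_mul_sub_chemPot_of_equilibria_hotAnchors_layered`** — `a·b·(n₂−n₁)·β(μ₂ − μ₁) ≥ β(af₁ + bf₂ − c − κ) −
  (aπ₁ + bπ₂ + β_{h,1}af₁ + β_{h,2}bf₂)`; threshold / cost forms: the one-`(β, μ)` exclusion
  **`IsVarEquilibrium.not_isVarEquilibrium_of_le_of_le_hotAnchors_layered_threshold_of_cost_le`** and the gap
  `mul_gap_le_mul_sub_chemPot_of_equilibria_hotAnchors_layered_threshold_of_cost_le`.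

READING: «the 2D `μ`-axis word of margin `M` (no jump of `n(μ)` across `[n₁,n₂]`, `Δμ ≥ M/(ab(n₂−n₁))`) is a word of the 3D layered crystal for every
stacking with `(4/π)Σ_b|t_{z,b}| < M`, with `M ↦ M − (4/π)Σ|t_z|` in the gap». HONEST SCOPE: translation-invariant mean-energy minimisers / variational
equilibria on `ℤ³` (existence not claimed, not needed); the interlayer cost is the CRUDE linear kinematic one; a floor on `Δμ`, not an estimate; inputs
are 2D claim nodes / kernel rows of the instance files; nothing about stripes, which phase is realised, superconductivity or `T_c`. Everything is
PROVED; no definition, no named fact, no number.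

## Mathlib / tree search
REUSED: `margin_le_mul_sub_chemPot_of_isMeanEnergyMinimiser`, `pressureMargin_le_mul_sub_chemPot_of_isVarEquilibrium` (`TIDensityPhaseCoexistenceGrandCanonical`);
`tiGroundEnergyDensityAt_layeredHubbardTTPrime_mem_Icc_sharp` (`SingleDirectionHoppingKinematicRow`); `varPressureAt_layeredHubbardTTPrime_mem_Icc_pressureTT'`
(`CanonicalVariationalPressure`); `pressureTT'_mem_Icc`, `pressureTT'_le_hotCeiling_sub_mul_of_floor`. `lean search 'layered.*chemPot|Minimiser.*layered.*not'`
(2026-08-28): only the canonical layered laws.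

## References
* R. B. Israel, *Convexity in the Theory of Lattice Gases* (1979), Thm. I.2.4, Thm. I.3.4. [cite: Israel1979, Thm. I.2.4]
* E. Pavarini, I. Dasgupta, T. Saha-Dasgupta, O. Jepsen, O. K. Andersen, Phys. Rev. Lett. 87 (2001) 047003, eq. (1). [cite: PavariniEtAl2001, eq. (1)]
* V. J. Emery, S. A. Kivelson, H. Q. Lin, Phys. Rev. Lett. 64 (1990) 475. [cite: EmeryKivelsonLin1990, pp. 475–476]
* D. Ruelle, *Statistical Mechanics: Rigorous Results* (1969), §3.4. [cite: Ruelle1969, §3.4]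
-/

noncomputable section

open scoped ComplexOrder BigOperators
open Filter Topology Set

namespace Literature.MathematicalPhysics.QuantumLattice

open Matrix HubbardWave0 Literature.Probability.LatticeModels ThermodynamicLimit InfVolFermionState FermionInteraction

/-- Weights: `n₁ ≤ an₁ + bn₂ ≤ n₂`. [folklore] -/
private theorem convexComb_mem_Icc'' {a b n₁ n₂ : ℝ} (ha : 0 ≤ a) (hb : 0 ≤ b) (hab : a + b = 1) (h : n₁ ≤ n₂) :
    n₁ ≤ a * n₁ + b * n₂ ∧ a * n₁ + b * n₂ ≤ n₂ := by
  have e1 : a * n₁ + b * n₂ - n₁ = b * (n₂ - n₁) := by linear_combination n₁ * hab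
  have e2 : n₂ - (a * n₁ + b * n₂) = a * (n₂ - n₁) := by linear_combination (-n₂) * hab
  constructor
  · nlinarith [mul_nonneg hb (sub_nonneg.2 h)]
  · nlinarith [mul_nonneg ha (sub_nonneg.2 h)]

namespace InfVolFermionState

/-! ### §1 `T = 0`: grand-canonical ground states of the layered crystal -/

section LayeredGround

variable (t t' : ℝ) {U : ℝ} (hU : 0 ≤ U) {κ : Type*} [Fintype κ] {w : κ → Site 3} (hw : ∀ b, w b 0 ≠ 0) (tz : κ → ℝ)
  {R' : ℝ} (hR' : 1 ≤ R') (hwR' : ∀ b, w b ∈ thicken ({0} : Finset (Site 3)) R')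
  {Γ Γ₁ Γ₂ : FermionInteraction 3} {R₀ R₁ R₂ μ μ₁ μ₂ : ℝ} {ω₁ ω₂ : InfVolFermionState 3}
include hU hw hR' hwR'

/-- **CERTIFIED `Δμ` GAP IN THE LAYERED CRYSTAL (`T = 0`) from 2D windows.** `U ≥ 0`; `Γᵢ` with `e_{Γᵢ} = e_{Φ₃} − μᵢρ` (`Φ₃` the layered crystal);
translation-invariant ground states `ω₁` of `Γ₁` with `ρ(ω₁) ≤ n₁` and `ω₂` of `Γ₂` with `n₂ ≤ ρ(ω₂)`, `0 < n₁ ≤ n₂ < 2`; weights `a, b ≥ 0`, `a + b = 1`;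
a 2D CAP `e(an₁ + bn₂) ≤ c` and 2D FLOORS `fᵢ ≤ e(nᵢ)`. Then `a·b·(n₂ − n₁)·(μ₂ − μ₁) ≥ af₁ + bf₂ − c − (4/π)Σ_b|tz_b|` (the 2D cap is a 3D cap,
the 2D floors drop by `κ`). [cite: Israel1979, Thm. I.2.4] [cite: EmeryKivelsonLin1990, pp. 475–476] -/
theorem margin_le_mul_sub_chemPot_of_groundStates_layered (hω₁ : ω₁.IsMeanEnergyMinimiser Γ₁ R₁)
    (hΓ₁ : ∀ σ : InfVolFermionState 3, σ.meanEnergy Γ₁ R₁ = σ.meanEnergy (layeredHubbardTTPrime t t' U w tz) R' - μ₁ * σ.density)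
    (hω₂ : ω₂.IsMeanEnergyMinimiser Γ₂ R₂)
    (hΓ₂ : ∀ σ : InfVolFermionState 3, σ.meanEnergy Γ₂ R₂ = σ.meanEnergy (layeredHubbardTTPrime t t' U w tz) R' - μ₂ * σ.density)
    {n₁ n₂ : ℝ} (hn₁0 : 0 < n₁) (hn₂2 : n₂ < 2) (hn₁ : ω₁.density ≤ n₁) (hn : n₁ ≤ n₂) (hn₂ : n₂ ≤ ω₂.density)
    {a b : ℝ} (ha : 0 ≤ a) (hb : 0 ≤ b) (hab : a + b = 1) {c f₁ f₂ : ℝ}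
    (hcap : energyDensityTT' t t' U (a * n₁ + b * n₂) ≤ c)
    (hf₁ : f₁ ≤ energyDensityTT' t t' U n₁) (hf₂ : f₂ ≤ energyDensityTT' t t' U n₂) :
    a * f₁ + b * f₂ - c - 4 / Real.pi * ∑ b, |tz b| ≤ a * b * (n₂ - n₁) * (μ₂ - μ₁) := by
  have hn₁2 : n₁ < 2 := lt_of_le_of_lt hn hn₂2
  have hn₂0 : 0 < n₂ := lt_of_lt_of_le hn₁0 hn
  obtain ⟨hmlo, hmhi⟩ := convexComb_mem_Icc'' ha hb hab hn
  have hm0 : 0 < a * n₁ + b * n₂ := lt_of_lt_of_le hn₁0 hmlo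
  have hm2 : a * n₁ + b * n₂ < 2 := lt_of_le_of_lt hmhi hn₂2
  have hcap' := (tiGroundEnergyDensityAt_layeredHubbardTTPrime_mem_Icc_sharp t t' hU hm0 hm2 hw tz hR' hwR').2.trans hcap
  have hf₁' := (tiGroundEnergyDensityAt_layeredHubbardTTPrime_mem_Icc_sharp t t' hU hn₁0 hn₁2 hw tz hR' hwR').1
  have hf₂' := (tiGroundEnergyDensityAt_layeredHubbardTTPrime_mem_Icc_sharp t t' hU hn₂0 hn₂2 hw tz hR' hwR').1
  have h := margin_le_mul_sub_chemPot_of_isMeanEnergyMinimiser (layeredHubbardTTPrime t t' U w tz) R' hω₁ hΓ₁ hω₂ hΓ₂ hn₁ hn hn₂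
    ha hb hab hcap' (f₁ := f₁ - 4 / Real.pi * ∑ b, |tz b|) (f₂ := f₂ - 4 / Real.pi * ∑ b, |tz b|) (by linarith) (by linarith)
  have e : a * (f₁ - 4 / Real.pi * ∑ b, |tz b|) + b * (f₂ - 4 / Real.pi * ∑ b, |tz b|) - c =
      a * f₁ + b * f₂ - c - (a + b) * (4 / Real.pi * ∑ b, |tz b|) := by ring
  rw [e, hab, one_mul] at h
  exact h

/-- **Cost form** («every stacking with `(4/π)Σ|tz| ≤ k`»): `a·b·(n₂ − n₁)·(μ₂ − μ₁) ≥ af₁ + bf₂ − c − k`. [cite: Israel1979, Thm. I.2.4] -/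
theorem margin_le_mul_sub_chemPot_of_groundStates_layered_of_cost_le (hω₁ : ω₁.IsMeanEnergyMinimiser Γ₁ R₁)
    (hΓ₁ : ∀ σ : InfVolFermionState 3, σ.meanEnergy Γ₁ R₁ = σ.meanEnergy (layeredHubbardTTPrime t t' U w tz) R' - μ₁ * σ.density)
    (hω₂ : ω₂.IsMeanEnergyMinimiser Γ₂ R₂)
    (hΓ₂ : ∀ σ : InfVolFermionState 3, σ.meanEnergy Γ₂ R₂ = σ.meanEnergy (layeredHubbardTTPrime t t' U w tz) R' - μ₂ * σ.density)
    {n₁ n₂ : ℝ} (hn₁0 : 0 < n₁) (hn₂2 : n₂ < 2) (hn₁ : ω₁.density ≤ n₁) (hn : n₁ ≤ n₂) (hn₂ : n₂ ≤ ω₂.density)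
    {a b : ℝ} (ha : 0 ≤ a) (hb : 0 ≤ b) (hab : a + b = 1) {c f₁ f₂ k : ℝ}
    (hcap : energyDensityTT' t t' U (a * n₁ + b * n₂) ≤ c)
    (hf₁ : f₁ ≤ energyDensityTT' t t' U n₁) (hf₂ : f₂ ≤ energyDensityTT' t t' U n₂) (hk : 4 / Real.pi * ∑ b, |tz b| ≤ k) :
    a * f₁ + b * f₂ - c - k ≤ a * b * (n₂ - n₁) * (μ₂ - μ₁) := by
  have h := margin_le_mul_sub_chemPot_of_groundStates_layered t t' hU hw tz hR' hwR' hω₁ hΓ₁ hω₂ hΓ₂ hn₁0 hn₂2 hn₁ hn hn₂ ha hb hab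
    hcap hf₁ hf₂
  linarith

/-- **NO `μ` CARRIES BOTH PHASES IN THE LAYERED CRYSTAL (`T = 0`)** for every stacking with `(4/π)Σ|tz| ≤ k` and `c + k < af₁ + bf₂`: if a
translation-invariant ground state of `H₃ − μN` has density `≤ n₁`, none has density `≥ n₂`. [cite: Israel1979, Thm. I.2.4] [cite: EmeryKivelsonLin1990, pp. 475–476] -/
theorem IsMeanEnergyMinimiser.not_isMeanEnergyMinimiser_of_le_of_le_layered_of_cost_lt (hω₁ : ω₁.IsMeanEnergyMinimiser Γ R₀)
    (hΓ : ∀ σ : InfVolFermionState 3, σ.meanEnergy Γ R₀ = σ.meanEnergy (layeredHubbardTTPrime t t' U w tz) R' - μ * σ.density)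
    {n₁ n₂ : ℝ} (hn₁0 : 0 < n₁) (hn₂2 : n₂ < 2) (hn₁ : ω₁.density ≤ n₁) (hn : n₁ ≤ n₂) (hn₂ : n₂ ≤ ω₂.density)
    {a b : ℝ} (ha : 0 ≤ a) (hb : 0 ≤ b) (hab : a + b = 1) {c f₁ f₂ k : ℝ}
    (hcap : energyDensityTT' t t' U (a * n₁ + b * n₂) ≤ c)
    (hf₁ : f₁ ≤ energyDensityTT' t t' U n₁) (hf₂ : f₂ ≤ energyDensityTT' t t' U n₂) (hk : 4 / Real.pi * ∑ b, |tz b| ≤ k)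
    (hM : c + k < a * f₁ + b * f₂) :
    ¬ ω₂.IsMeanEnergyMinimiser Γ R₀ := by
  intro hω₂
  have h := margin_le_mul_sub_chemPot_of_groundStates_layered_of_cost_le t t' hU hw tz hR' hwR' hω₁ hΓ hω₂ hΓ hn₁0 hn₂2 hn₁ hn hn₂
    ha hb hab hcap hf₁ hf₂ hk
  rw [sub_self, mul_zero] at h
  linarith

end LayeredGround

/-! ### §2 `T > 0`: grand-canonical equilibrium states of the layered crystal, hot-anchored 2D windows -/

section LayeredThermal

variable (t t' : ℝ) {U : ℝ} (hU : 0 ≤ U) {β : ℝ} (hβ : 0 < β) {κ : Type*} [Fintype κ] {w : κ → Site 3} (hw : ∀ b, w b 0 ≠ 0)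
  (tz : κ → ℝ) {R' : ℝ} (hR' : 1 ≤ R') (hwR' : ∀ b, w b ∈ thicken ({0} : Finset (Site 3)) R')
  {Γ Γ₁ Γ₂ : FermionInteraction 3} {R₀ R₁ R₂ μ μ₁ μ₂ : ℝ} {ω₁ ω₂ : InfVolFermionState 3}
include hU hβ hw hR' hwR'

/-- **CERTIFIED `Δμ` GAP IN THE LAYERED CRYSTAL AT `T > 0` from hot-anchored 2D windows.** `U ≥ 0`, `β > 0`; variational equilibria `ω₁` of `Γ₁`
(`e_{Γ₁} = e_{Φ₃} − μ₁ρ`) with `ρ(ω₁) ≤ n₁` and `ω₂` of `Γ₂` with `n₂ ≤ ρ(ω₂)`, `0 < n₁ ≤ n₂ < 2`; 2D inputs: cap `e(an₁ + bn₂) ≤ c`, floors `fᵢ ≤ e(nᵢ)`,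
pressure ceilings `p(β_{h,i}; nᵢ) ≤ πᵢ` at `0 ≤ β_{h,i} ≤ β`. Then
`a·b·(n₂ − n₁)·β(μ₂ − μ₁) ≥ β(af₁ + bf₂ − c − (4/π)Σ_b|tz_b|) − (aπ₁ + bπ₂ + β_{h,1}af₁ + β_{h,2}bf₂)`
(floor `P₃ ≥ p ≥ −βc` at the mean density; caps `P₃(nᵢ) ≤ πᵢ − (β − β_{h,i})fᵢ + βκ`). [cite: Israel1979, Thm. I.2.4] [cite: PavariniEtAl2001, eq. (1)] -/
theorem margin_le_mul_sub_chemPot_of_equilibria_hotAnchors_layered (hω₁ : ω₁.IsVarEquilibrium β Γ₁ R₁)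
    (hΓ₁ : ∀ σ : InfVolFermionState 3, σ.meanEnergy Γ₁ R₁ = σ.meanEnergy (layeredHubbardTTPrime t t' U w tz) R' - μ₁ * σ.density)
    (hω₂ : ω₂.IsVarEquilibrium β Γ₂ R₂)
    (hΓ₂ : ∀ σ : InfVolFermionState 3, σ.meanEnergy Γ₂ R₂ = σ.meanEnergy (layeredHubbardTTPrime t t' U w tz) R' - μ₂ * σ.density)
    {n₁ n₂ : ℝ} (hn₁0 : 0 < n₁) (hn₂2 : n₂ < 2) (hn₁ : ω₁.density ≤ n₁) (hn : n₁ ≤ n₂) (hn₂ : n₂ ≤ ω₂.density)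
    {a b : ℝ} (ha : 0 ≤ a) (hb : 0 ≤ b) (hab : a + b = 1) {c f₁ f₂ : ℝ}
    (hcap : energyDensityTT' t t' U (a * n₁ + b * n₂) ≤ c)
    (hf₁ : f₁ ≤ energyDensityTT' t t' U n₁) (hf₂ : f₂ ≤ energyDensityTT' t t' U n₂)
    {βh₁ βh₂ π₁ π₂ : ℝ} (hβh₁ : 0 ≤ βh₁) (hβh₂ : 0 ≤ βh₂) (hle₁ : βh₁ ≤ β) (hle₂ : βh₂ ≤ β)
    (hπ₁ : pressureTT' βh₁ t t' U n₁ ≤ π₁) (hπ₂ : pressureTT' βh₂ t t' U n₂ ≤ π₂) :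
    β * (a * f₁ + b * f₂ - c - 4 / Real.pi * ∑ b, |tz b|) - (a * π₁ + b * π₂ + βh₁ * (a * f₁) + βh₂ * (b * f₂)) ≤
      a * b * (n₂ - n₁) * (β * (μ₂ - μ₁)) := by
  have hn₁2 : n₁ < 2 := lt_of_le_of_lt hn hn₂2
  have hn₂0 : 0 < n₂ := lt_of_lt_of_le hn₁0 hn
  obtain ⟨hmlo, hmhi⟩ := convexComb_mem_Icc'' ha hb hab hn
  have hm0 : 0 < a * n₁ + b * n₂ := lt_of_lt_of_le hn₁0 hmlo
  have hm2 : a * n₁ + b * n₂ < 2 := lt_of_le_of_lt hmhi hn₂2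
  set K : ℝ := 4 / Real.pi * ∑ b, |tz b| with hK
  have hW : -(β * c) ≤ (layeredHubbardTTPrime t t' U w tz).varPressureAt β R' (a * n₁ + b * n₂) := by
    have h1 := (varPressureAt_layeredHubbardTTPrime_mem_Icc_pressureTT' hβ t t' hU hw tz hR' hwR' hm0 hm2).1
    have h2 := (pressureTT'_mem_Icc hβ.le t t' hU hm0.le hm2).1
    nlinarith [mul_le_mul_of_nonneg_left hcap hβ.le]
  have hQ₁ : (layeredHubbardTTPrime t t' U w tz).varPressureAt β R' n₁ ≤ π₁ - (β - βh₁) * f₁ + β * K := by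
    have h1 := (varPressureAt_layeredHubbardTTPrime_mem_Icc_pressureTT' hβ t t' hU hw tz hR' hwR' hn₁0 hn₁2).2
    have h2 := pressureTT'_le_hotCeiling_sub_mul_of_floor t t' hU hn₁0.le hn₁2 hβh₁ hle₁ hπ₁ hf₁
    rw [hK]; linarith
  have hQ₂ : (layeredHubbardTTPrime t t' U w tz).varPressureAt β R' n₂ ≤ π₂ - (β - βh₂) * f₂ + β * K := by
    have h1 := (varPressureAt_layeredHubbardTTPrime_mem_Icc_pressureTT' hβ t t' hU hw tz hR' hwR' hn₂0 hn₂2).2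
    have h2 := pressureTT'_le_hotCeiling_sub_mul_of_floor t t' hU hn₂0.le hn₂2 hβh₂ hle₂ hπ₂ hf₂
    rw [hK]; linarith
  have h := pressureMargin_le_mul_sub_chemPot_of_isVarEquilibrium (by norm_num : (0 : ℕ) < 3) β (layeredHubbardTTPrime t t' U w tz) R'
    hω₁ hΓ₁ hω₂ hΓ₂ hn₁ hn hn₂ ha hb hab hW hQ₁ hQ₂
  have e : -(β * c) - a * (π₁ - (β - βh₁) * f₁ + β * K) - b * (π₂ - (β - βh₂) * f₂ + β * K) =
      β * (a * f₁ + b * f₂) - β * c - (a + b) * (β * K) - (a * π₁ + b * π₂ + βh₁ * (a * f₁) + βh₂ * (b * f₂)) := by ring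
  rw [e, hab, one_mul] at h
  have e2 : β * (a * f₁ + b * f₂ - c - K) = β * (a * f₁ + b * f₂) - β * c - β * K := by ring
  rw [e2]
  linarith

/-- **NO `(β, μ)` CARRIES BOTH PHASES IN THE LAYERED CRYSTAL, threshold / cost form** («for every `β ≥ β₀` and every stacking with
`(4/π)Σ|tz| ≤ k`»): with `M₀ := af₁ + bf₂ − c − k ≥ 0`, `aπ₁ + bπ₂ + β_{h,1}af₁ + β_{h,2}bf₂ < β₀·M₀`, `β_{h,i} ≤ β₀ ≤ β`: if `H₃ − μN` has a
translation-invariant variational equilibrium at `β` of density `≤ n₁`, it has none of density `≥ n₂`. [cite: Israel1979, Thm. I.2.4] [cite: PavariniEtAl2001, eq. (1)] -/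
theorem IsVarEquilibrium.not_isVarEquilibrium_of_le_of_le_hotAnchors_layered_threshold_of_cost_le (hω₁ : ω₁.IsVarEquilibrium β Γ R₀)
    (hΓ : ∀ σ : InfVolFermionState 3, σ.meanEnergy Γ R₀ = σ.meanEnergy (layeredHubbardTTPrime t t' U w tz) R' - μ * σ.density)
    {n₁ n₂ : ℝ} (hn₁0 : 0 < n₁) (hn₂2 : n₂ < 2) (hn₁ : ω₁.density ≤ n₁) (hn : n₁ ≤ n₂) (hn₂ : n₂ ≤ ω₂.density)
    {a b : ℝ} (ha : 0 ≤ a) (hb : 0 ≤ b) (hab : a + b = 1) {c f₁ f₂ : ℝ}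
    (hcap : energyDensityTT' t t' U (a * n₁ + b * n₂) ≤ c)
    (hf₁ : f₁ ≤ energyDensityTT' t t' U n₁) (hf₂ : f₂ ≤ energyDensityTT' t t' U n₂)
    {βh₁ βh₂ π₁ π₂ β₀ k : ℝ} (hβh₁ : 0 ≤ βh₁) (hβh₂ : 0 ≤ βh₂) (h0₁ : βh₁ ≤ β₀) (h0₂ : βh₂ ≤ β₀) (hβ₀ : β₀ ≤ β)
    (hπ₁ : pressureTT' βh₁ t t' U n₁ ≤ π₁) (hπ₂ : pressureTT' βh₂ t t' U n₂ ≤ π₂) (hk : 4 / Real.pi * ∑ b, |tz b| ≤ k)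
    (hMnn : 0 ≤ a * f₁ + b * f₂ - c - k)
    (hM₀ : a * π₁ + b * π₂ + βh₁ * (a * f₁) + βh₂ * (b * f₂) < β₀ * (a * f₁ + b * f₂ - c - k)) :
    ¬ ω₂.IsVarEquilibrium β Γ R₀ := by
  intro hω₂
  have h := margin_le_mul_sub_chemPot_of_equilibria_hotAnchors_layered t t' hU hβ hw tz hR' hwR' hω₁ hΓ hω₂ hΓ hn₁0 hn₂2 hn₁ hn hn₂
    ha hb hab hcap hf₁ hf₂ hβh₁ hβh₂ (h0₁.trans hβ₀) (h0₂.trans hβ₀) hπ₁ hπ₂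
  rw [sub_self, mul_zero, mul_zero] at h
  have k1 : β₀ * (a * f₁ + b * f₂ - c - k) ≤ β * (a * f₁ + b * f₂ - c - k) := mul_le_mul_of_nonneg_right hβ₀ hMnn
  have k2 : β * (a * f₁ + b * f₂ - c - k) ≤ β * (a * f₁ + b * f₂ - c - 4 / Real.pi * ∑ b, |tz b|) :=
    mul_le_mul_of_nonneg_left (by linarith) hβ.le
  linarith

/-- **Gap, threshold / cost form** («for every `β ≥ β₀` and every stacking with `(4/π)Σ|tz| ≤ k` the distance is `≥ g/(ab(n₂−n₁))`»): with
`g ≤ M₀ := af₁ + bf₂ − c − k`, `aπ₁ + bπ₂ + β_{h,1}af₁ + β_{h,2}bf₂ ≤ β₀·(M₀ − g)`, `β_{h,i} ≤ β₀ ≤ β`: `β·g ≤ a·b·(n₂ − n₁)·β(μ₂ − μ₁)`.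
[cite: Israel1979, Thm. I.2.4] [cite: PavariniEtAl2001, eq. (1)] -/
theorem mul_gap_le_mul_sub_chemPot_of_equilibria_hotAnchors_layered_threshold_of_cost_le (hω₁ : ω₁.IsVarEquilibrium β Γ₁ R₁)
    (hΓ₁ : ∀ σ : InfVolFermionState 3, σ.meanEnergy Γ₁ R₁ = σ.meanEnergy (layeredHubbardTTPrime t t' U w tz) R' - μ₁ * σ.density)
    (hω₂ : ω₂.IsVarEquilibrium β Γ₂ R₂)
    (hΓ₂ : ∀ σ : InfVolFermionState 3, σ.meanEnergy Γ₂ R₂ = σ.meanEnergy (layeredHubbardTTPrime t t' U w tz) R' - μ₂ * σ.density)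
    {n₁ n₂ : ℝ} (hn₁0 : 0 < n₁) (hn₂2 : n₂ < 2) (hn₁ : ω₁.density ≤ n₁) (hn : n₁ ≤ n₂) (hn₂ : n₂ ≤ ω₂.density)
    {a b : ℝ} (ha : 0 ≤ a) (hb : 0 ≤ b) (hab : a + b = 1) {c f₁ f₂ : ℝ}
    (hcap : energyDensityTT' t t' U (a * n₁ + b * n₂) ≤ c)
    (hf₁ : f₁ ≤ energyDensityTT' t t' U n₁) (hf₂ : f₂ ≤ energyDensityTT' t t' U n₂)
    {βh₁ βh₂ π₁ π₂ β₀ k g : ℝ} (hβh₁ : 0 ≤ βh₁) (hβh₂ : 0 ≤ βh₂) (h0₁ : βh₁ ≤ β₀) (h0₂ : βh₂ ≤ β₀) (hβ₀ : β₀ ≤ β)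
    (hπ₁ : pressureTT' βh₁ t t' U n₁ ≤ π₁) (hπ₂ : pressureTT' βh₂ t t' U n₂ ≤ π₂) (hk : 4 / Real.pi * ∑ b, |tz b| ≤ k)
    (hgM : g ≤ a * f₁ + b * f₂ - c - k)
    (hN : a * π₁ + b * π₂ + βh₁ * (a * f₁) + βh₂ * (b * f₂) ≤ β₀ * (a * f₁ + b * f₂ - c - k - g)) :
    β * g ≤ a * b * (n₂ - n₁) * (β * (μ₂ - μ₁)) := by
  have h := margin_le_mul_sub_chemPot_of_equilibria_hotAnchors_layered t t' hU hβ hw tz hR' hwR' hω₁ hΓ₁ hω₂ hΓ₂ hn₁0 hn₂2 hn₁ hn hn₂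
    ha hb hab hcap hf₁ hf₂ hβh₁ hβh₂ (h0₁.trans hβ₀) (h0₂.trans hβ₀) hπ₁ hπ₂
  have k1 : β₀ * (a * f₁ + b * f₂ - c - k - g) ≤ β * (a * f₁ + b * f₂ - c - k - g) :=
    mul_le_mul_of_nonneg_right hβ₀ (by linarith)
  have k2 : β * (a * f₁ + b * f₂ - c - k) ≤ β * (a * f₁ + b * f₂ - c - 4 / Real.pi * ∑ b, |tz b|) :=
    mul_le_mul_of_nonneg_left (by linarith) hβ.le
  nlinarith [h, k1, k2]

end LayeredThermal

end InfVolFermionState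

end Literature.MathematicalPhysics.QuantumLattice

end
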